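import Literature.Probability.Percolation.KestenRelationRussoProofs
import Literature.Probability.Percolation.TriSubcriticalCrossingProofs
import HarnessLib

/-!
# Kesten's scaling relation `|p - 1/2| · L_ε(p)² · π₄(L_ε(p)) ≍ 1`: reduction to its last leaf (proofs only)

Topic `Literature/Probability/Percolation`; family `crit-perc`, statement **crit-perc.S16**
(`Literature.Probability.Percolation.triTheta_exponent`). Sibling proof file of `KestenScaling.lean`
(no new definitions, no new named facts), continuing `KestenRelationRusso.lean` /
`KestenRelationRussoProofs.lean`.

The named fact `Nolin2008_prop34` (`KestenScaling.lean`; Nolin, *Electron. J. Probab.* **13**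
(2008), Prop. 34 [arXiv 0711.4948: Prop. 32]; Kesten 1987, (4.5)) was reduced in
`KestenRelationRusso.lean` (`Nolin2008_prop34_of_russo`, PROVED: Russo's formula for the rhombus
crossing and the mean value inequality between `p` and `1/2` at the scale `N = L_ε(p)`) to three
named facts: the self-duality of the rhombus `BollobasRiordan2006_ch5_lemma7`, the sub-critical
decay of rhombus crossings `Nolin2008_subcritical_crossing`, and the pivotal count below the
characteristic length `Werner2009_lemma62`. The first two now HOLD
(`BollobasRiordan2006_ch5_lemma7_holds`, `KestenRelationRussoProofs.lean`, from the Hex theorem;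
`BollobasRiordan2006_tri_expDecay_holds`, `TriSubcriticalCrossingProofs.lean`, with
`Nolin2008_subcritical_crossing_of_expDecay`). This file records the resulting state of the
discharge of `Nolin2008_prop34`:

* `Nolin2008_prop34_of_lemma62 : Werner2009_lemma62 → Nolin2008_prop34` — Kesten's relation from
  its SINGLE remaining leaf, the two-sided pivotal count
  `Σ_{v ∈ [0,N]²} P_t(v pivotal for 𝒞_H([0,N]²)) ≍ N² π₄(N)` for `t` near `1/2` and `N ≤ L_ε(t)`
  (Werner 2009, Lecture 6, Lemma 6.2 with Lemma 6.3; Nolin 2008, display of Remark 35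
  [arXiv: Remark 34, eq. (7.27)] with Thm. 27 [arXiv: Thm. 26]); the discharge
  `Nolin2008_prop34_holds` is this theorem applied to `Werner2009_lemma62_holds` once that lands;
* `Nolin2008_prop34_at_of_pivotalCount` — the same at ONE fixed `ε ∈ (0, 1/2)`: Kesten's relation
  at `ε` (the body of `Nolin2008_prop34` at `ε`, which is exactly what the `_at` assembly
  `triTheta_exponent_of_scaling_at` of `KestenScaling.lean` consumes) from the pivotal count at the
  same `ε` only, so that an `ε`-restricted discharge of the pivotal count (Werner states Lemma 6.2
  for `ε` below a threshold) already feeds crit-perc.S16;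
* the two directions separately, as printed by Nolin (Remark 35 [arXiv: Remark 34]: "the
  intermediate lemma was required for the lower bound only, the upper bound can be obtained
  directly from Russo's formula"): `Nolin2008_prop34_upper_at_of_pivotal_lower` — the UPPER bound
  `|p - 1/2| L_ε(p)² π₄(L_ε(p)) ≤ C` from the LOWER pivotal bound
  `c N² π₄(N) ≤ Σ_v P_t(v pivotal)` alone (Werner 2009, Cor. 6.3: "`(p - 1/2) × L(p)² π̂_p(L(p)) ≤ 1`"),
  and `Nolin2008_prop34_lower_at_of_pivotal_upper` — the LOWER bound from the UPPER pivotal bound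
  alone (Werner 2009, display after Lemma 6.3), each for `p` on both sides of `1/2`
  (`L_ε(p) = L_ε(1 - p)`), with the `p < 1/2` cores `KestenScalingProofs.upper_of_lt_half`,
  `KestenScalingProofs.lower_of_lt_half`.

## The printed proof (Nolin 2008, §7.3, proof of Prop. 34; Werner 2009, Lecture 6, §5)

For `p < 1/2` and `N = L_ε(p)`, `f(t) = P_t(𝒞_H([0,N]²))` satisfies `f(1/2) = 1/2` (self-duality),
`0 ≤ f(p) ≤ ε` (definition of `L_ε`), and `f'(t) = Σ_v P_t(v pivotal)` (Russo). Since `L_ε` is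
non-decreasing on `[p, 1/2)`, `N ≤ L_ε(t)` for `t ∈ [p, 1/2)`, so the pivotal bounds apply on the
whole interval: `c N² π₄(N) ≤ f'` gives `c N² π₄(N) (1/2 - p) ≤ f(1/2) - f(p) ≤ 1/2` (upper bound of
Kesten's relation), and `f' ≤ C N² π₄(N)` gives `1/2 - ε ≤ f(1/2) - f(p) ≤ C N² π₄(N) (1/2 - p)`
(lower bound). The threshold `n₁ ≤ N` of the pivotal estimate is met near `1/2` by Nolin's Prop. 4,
`L_ε(p) → ∞` (`le_charLength_eventually`, proved in `KestenRelationRusso.lean`).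

What is NOT here: the pivotal count itself (`Werner2009_lemma62`: four-arm separation near
criticality, the near-critical stability of arm events, Nolin's Thm. 27, and the boundary
three-arm analysis for the upper count) — a theory of its own (Kesten 1987; Nolin 2008, §§4–6).

## References

* P. Nolin, Near-critical percolation in two dimensions, *Electron. J. Probab.* 13 (2008),
  §7.3, Prop. 34 and Remark 35 (arXiv 0711.4948: Prop. 32, Remark 34) [Nolin2008].
* W. Werner, Lectures on two-dimensional critical percolation, PCMI 16 (2009), Lecture 6,
  Lemma 6.2, Cor. 6.3, Lemma 6.3 [WernerPCMI2009].
* H. Kesten, Scaling relations for 2D-percolation, *Comm. Math. Phys.* 109 (1987), (4.5)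
  [KestenScalingCMP1987].
* B. Bollobás, O. Riordan, *Percolation*, CUP 2006, Ch. 5, Lemma 7, Thm. 8 [BollobasRiordan2006].
-/

noncomputable section

open Filter Topology MeasureTheory Set
open scoped unitInterval

namespace Literature.Probability.Percolation

open LatticeModels

/-! ### The two directions of the integration, `p < 1/2` -/

/-- **Upper bound of Kesten's relation from the lower pivotal bound, `p < 1/2`** (Nolin 2008,
Remark 35 [arXiv: Remark 34]: "the upper bound can be obtained directly from Russo's formula";
Werner 2009, Lecture 6, Cor. 6.3: integrating `c N² π₄(N) ≤ d/dt P_t(𝒞_H([0,N]²))` over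
`[p, 1/2]` at `N = L_ε(p)` gives `c N² π₄(N) (1/2 - p) ≤ P_{1/2} - P_p ≤ 1/2`). The self-duality
`P_{1/2}(𝒞_H([0,N]²)) = 1/2` and the sub-critical decay making `L_ε` a minimum are the tree's
theorems `BollobasRiordan2006_ch5_lemma7_holds`, `BollobasRiordan2006_tri_expDecay_holds`. [cite: Nolin2008, §7.3, proof of Prop. 34 and Remark 35 (arXiv 0711.4948: Prop. 32, Remark 34)] [cite: WernerPCMI2009, Lecture 6, Cor. 6.3] -/
theorem KestenScalingProofs.upper_of_lt_half {ε : ℝ} (hε : 0 < ε)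
    {r₀ n₁ : ℕ} {δ c : ℝ} (hc : 0 < c)
    (hlow : ∀ t : unitInterval, |(t : ℝ) - 1 / 2| < δ →
      ∀ N : ℕ, n₁ ≤ N → ((t : ℝ) ≠ 1 / 2 → N ≤ charLength ε t) →
        c * ((N : ℝ) ^ 2 * critFourArmProb r₀ N) ≤ rhombusPivotalSum t N)
    {δ' : ℝ} (hδ'δ : δ' ≤ δ) (hδ'4 : δ' ≤ 1 / 4)
    (hL : ∀ p : unitInterval, 1 / 2 - δ' < (p : ℝ) → (p : ℝ) < 1 / 2 → n₁ ≤ charLength ε p)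
    {p : unitInterval} (hp : (p : ℝ) < 1 / 2) (hpδ : |(p : ℝ) - 1 / 2| < δ') :
    |(p : ℝ) - 1 / 2| * (charLength ε p : ℝ) ^ 2 * critFourArmProb r₀ (charLength ε p) ≤
      1 / (2 * c) := by
  have h7 : BollobasRiordan2006_ch5_lemma7 := BollobasRiordan2006_ch5_lemma7_holds
  have hsub : Nolin2008_subcritical_crossing :=
    Nolin2008_subcritical_crossing_of_expDecay BollobasRiordan2006_tri_expDecay_holds
  set N : ℕ := charLength ε p with hN
  have hp1 : 1 / 2 - δ' < (p : ℝ) := by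
    have := (abs_sub_lt_iff.1 hpδ).2; linarith
  have hp0 : 0 < (p : ℝ) := by linarith
  have hn₁ : n₁ ≤ N := hL p hp1 hp
  -- the crossing probability as a function of a real parameter
  set f : ℝ → ℝ := fun r => triLRCrossingProb (projIcc (0 : ℝ) 1 zero_le_one r) N N with hf
  have hfhalf : f (1 / 2) = 1 / 2 := by
    have hproj : projIcc (0 : ℝ) 1 zero_le_one (1 / 2) = half :=
      Subtype.ext (by rw [projIcc_of_mem zero_le_one ⟨by norm_num, by norm_num⟩]; rfl)
    simp only [hf, hproj, h7 N]
  have hfp0 : 0 ≤ f p := measureReal_nonneg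
  -- derivative on `[p, 1/2]` and the lower pivotal bound there
  set D : Set ℝ := Icc (p : ℝ) (1 / 2) with hD
  have hIoo : ∀ q ∈ D, q ∈ Ioo (0 : ℝ) 1 :=
    fun q hq => ⟨hp0.trans_le hq.1, hq.2.trans_lt (by norm_num)⟩
  have hderiv : ∀ q ∈ D,
      HasDerivAt f (rhombusPivotalSum (projIcc (0 : ℝ) 1 zero_le_one q) N) q :=
    fun q hq => hasDerivAt_triLRCrossingProb N (hIoo q hq)
  have hcont : ContinuousOn f D := fun q hq => (hderiv q hq).continuousAt.continuousWithinAt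
  have hdiff : DifferentiableOn ℝ f (interior D) := fun q hq =>
    (hderiv q (interior_subset hq)).differentiableAt.differentiableWithinAt
  have hbound : ∀ q ∈ interior D, c * ((N : ℝ) ^ 2 * critFourArmProb r₀ N) ≤ deriv f q := by
    intro q hq
    rw [hD, interior_Icc] at hq
    rw [(hderiv q (Ioo_subset_Icc_self hq)).deriv]
    set t : unitInterval := projIcc (0 : ℝ) 1 zero_le_one q with ht
    have htq : (t : ℝ) = q := by
      rw [ht, projIcc_of_mem zero_le_one ⟨(hp0.trans hq.1).le, (hq.2.trans (by norm_num)).le⟩]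
    have ht1 : |(t : ℝ) - 1 / 2| < δ := by
      rw [htq, abs_sub_lt_iff]; constructor <;> linarith [hq.1, hq.2]
    have ht2 : (t : ℝ) ≠ 1 / 2 → N ≤ charLength ε t := fun _ =>
      charLength_le_charLength hsub hε (Subtype.coe_le_coe.1 (by rw [htq]; exact hq.1.le))
        (by rw [htq]; exact hq.2)
    exact hlow t ht1 N hn₁ ht2
  have hpD : (p : ℝ) ∈ D := ⟨le_rfl, hp.le⟩
  have hhD : (1 / 2 : ℝ) ∈ D := ⟨hp.le, le_rfl⟩
  -- mean value inequality: `c · X · (1/2 - p) ≤ f(1/2) - f(p) ≤ 1/2`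
  have hmv := (convex_Icc (p : ℝ) (1 / 2)).mul_sub_le_image_sub_of_le_deriv hcont hdiff
    hbound _ hpD _ hhD hp.le
  rw [hfhalf] at hmv
  have habs : |(p : ℝ) - 1 / 2| = 1 / 2 - p := by
    rw [abs_sub_comm]; exact abs_of_nonneg (by linarith)
  have hX0 : 0 ≤ (N : ℝ) ^ 2 * critFourArmProb r₀ N := by
    have : 0 ≤ critFourArmProb r₀ N := measureReal_nonneg
    positivity
  rw [habs, le_div_iff₀ (by positivity)]
  nlinarith [hmv, hfp0, hX0]

/-- **Lower bound of Kesten's relation from the upper pivotal bound, `p < 1/2`** (Nolin 2008,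
proof of Prop. 34: "by construction of `L(p)`, the variation of the crossing event is of order
`1`"; Werner 2009, Lecture 6, display after Lemma 6.3: integrating
`d/dt P_t(𝒞_H([0,N]²)) ≤ C N² π₄(N)` over `[p, 1/2]` at `N = L_ε(p)`, where `P_p ≤ ε` and
`P_{1/2} = 1/2`, gives `1/2 - ε ≤ C N² π₄(N) (1/2 - p)`). [cite: Nolin2008, §7.3, proof of Prop. 34 (arXiv 0711.4948: Prop. 32)] [cite: WernerPCMI2009, Lecture 6, display after Lemma 6.3] -/
theorem KestenScalingProofs.lower_of_lt_half {ε : ℝ} (hε : 0 < ε)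
    {r₀ n₁ : ℕ} {δ C : ℝ}
    (hup : ∀ t : unitInterval, |(t : ℝ) - 1 / 2| < δ →
      ∀ N : ℕ, n₁ ≤ N → ((t : ℝ) ≠ 1 / 2 → N ≤ charLength ε t) →
        rhombusPivotalSum t N ≤ C * ((N : ℝ) ^ 2 * critFourArmProb r₀ N))
    {δ' : ℝ} (hδ'δ : δ' ≤ δ) (hδ'4 : δ' ≤ 1 / 4)
    (hL : ∀ p : unitInterval, 1 / 2 - δ' < (p : ℝ) → (p : ℝ) < 1 / 2 → n₁ ≤ charLength ε p)
    {p : unitInterval} (hp : (p : ℝ) < 1 / 2) (hpδ : |(p : ℝ) - 1 / 2| < δ') :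
    (1 / 2 - ε) / max C 1 ≤
      |(p : ℝ) - 1 / 2| * (charLength ε p : ℝ) ^ 2 * critFourArmProb r₀ (charLength ε p) := by
  have h7 : BollobasRiordan2006_ch5_lemma7 := BollobasRiordan2006_ch5_lemma7_holds
  have hsub : Nolin2008_subcritical_crossing :=
    Nolin2008_subcritical_crossing_of_expDecay BollobasRiordan2006_tri_expDecay_holds
  set N : ℕ := charLength ε p with hN
  have hp1 : 1 / 2 - δ' < (p : ℝ) := by
    have := (abs_sub_lt_iff.1 hpδ).2; linarith
  have hp0 : 0 < (p : ℝ) := by linarith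
  have hn₁ : n₁ ≤ N := hL p hp1 hp
  -- the crossing probability as a function of a real parameter
  set f : ℝ → ℝ := fun r => triLRCrossingProb (projIcc (0 : ℝ) 1 zero_le_one r) N N with hf
  have hfhalf : f (1 / 2) = 1 / 2 := by
    have hproj : projIcc (0 : ℝ) 1 zero_le_one (1 / 2) = half :=
      Subtype.ext (by rw [projIcc_of_mem zero_le_one ⟨by norm_num, by norm_num⟩]; rfl)
    simp only [hf, hproj, h7 N]
  have hfp : f p ≤ ε := by
    simp only [hf, projIcc_val zero_le_one p]
    exact triLRCrossingProb_charLength_le' hsub hε hp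
  -- derivative on `[p, 1/2]` and the upper pivotal bound there
  set D : Set ℝ := Icc (p : ℝ) (1 / 2) with hD
  have hIoo : ∀ q ∈ D, q ∈ Ioo (0 : ℝ) 1 :=
    fun q hq => ⟨hp0.trans_le hq.1, hq.2.trans_lt (by norm_num)⟩
  have hderiv : ∀ q ∈ D,
      HasDerivAt f (rhombusPivotalSum (projIcc (0 : ℝ) 1 zero_le_one q) N) q :=
    fun q hq => hasDerivAt_triLRCrossingProb N (hIoo q hq)
  have hcont : ContinuousOn f D := fun q hq => (hderiv q hq).continuousAt.continuousWithinAt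
  have hdiff : DifferentiableOn ℝ f (interior D) := fun q hq =>
    (hderiv q (interior_subset hq)).differentiableAt.differentiableWithinAt
  have hbound : ∀ q ∈ interior D, deriv f q ≤ max C 1 * ((N : ℝ) ^ 2 * critFourArmProb r₀ N) := by
    intro q hq
    rw [hD, interior_Icc] at hq
    rw [(hderiv q (Ioo_subset_Icc_self hq)).deriv]
    set t : unitInterval := projIcc (0 : ℝ) 1 zero_le_one q with ht
    have htq : (t : ℝ) = q := by
      rw [ht, projIcc_of_mem zero_le_one ⟨(hp0.trans hq.1).le, (hq.2.trans (by norm_num)).le⟩]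
    have ht1 : |(t : ℝ) - 1 / 2| < δ := by
      rw [htq, abs_sub_lt_iff]; constructor <;> linarith [hq.1, hq.2]
    have ht2 : (t : ℝ) ≠ 1 / 2 → N ≤ charLength ε t := fun _ =>
      charLength_le_charLength hsub hε (Subtype.coe_le_coe.1 (by rw [htq]; exact hq.1.le))
        (by rw [htq]; exact hq.2)
    refine (hup t ht1 N hn₁ ht2).trans ?_
    exact mul_le_mul_of_nonneg_right (le_max_left C 1)
      (mul_nonneg (sq_nonneg _) measureReal_nonneg)
  have hpD : (p : ℝ) ∈ D := ⟨le_rfl, hp.le⟩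
  have hhD : (1 / 2 : ℝ) ∈ D := ⟨hp.le, le_rfl⟩
  -- mean value inequality: `1/2 - ε ≤ f(1/2) - f(p) ≤ max C 1 · X · (1/2 - p)`
  have hmv := (convex_Icc (p : ℝ) (1 / 2)).image_sub_le_mul_sub_of_deriv_le hcont hdiff
    hbound _ hpD _ hhD hp.le
  rw [hfhalf] at hmv
  have habs : |(p : ℝ) - 1 / 2| = 1 / 2 - p := by
    rw [abs_sub_comm]; exact abs_of_nonneg (by linarith)
  have hX0 : 0 ≤ (N : ℝ) ^ 2 * critFourArmProb r₀ N := by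
    have : 0 ≤ critFourArmProb r₀ N := measureReal_nonneg
    positivity
  have hmax : 0 < max C 1 := lt_max_of_lt_right one_pos
  rw [habs, div_le_iff₀ hmax]
  nlinarith [hmv, hfp, hX0]

/-! ### The two directions near `1/2`, both sides, at a fixed `ε` -/

/-- **Upper bound of Kesten's relation from the lower pivotal count, at a fixed `ε`** (Nolin 2008,
Remark 35 [arXiv: Remark 34]; Werner 2009, Lecture 6, Cor. 6.3: "for all `p > 1/2`,
`(p - 1/2) × L(p)² π̂_p(L(p)) ≤ 1`"): if for every large inner radius `r₀` the lower pivotal bound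
`c N² π₄(N) ≤ Σ_{v ∈ [0,N]²} P_t(v pivotal)` holds for `t` near `1/2` and `n₁ ≤ N ≤ L_ε(t)`, then
`|p - 1/2| L_ε(p)² π₄(L_ε(p)) ≤ C` on a punctured neighbourhood of `1/2` (the case `p > 1/2`
being the case `1 - p`, `L_ε(p) = L_ε(1 - p)`). [cite: Nolin2008, §7.3, Remark 35 (arXiv 0711.4948: Remark 34)] [cite: WernerPCMI2009, Lecture 6, Cor. 6.3] -/
theorem Nolin2008_prop34_upper_at_of_pivotal_lower {ε : ℝ} (hε : 0 < ε) (hε' : ε < 1 / 2)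
    (hlow : ∃ r₁ : ℕ, ∀ r₀ ≥ r₁, ∃ n₁ : ℕ, ∃ δ > (0 : ℝ), ∃ c > (0 : ℝ),
      ∀ t : unitInterval, |(t : ℝ) - 1 / 2| < δ →
        ∀ N : ℕ, n₁ ≤ N → ((t : ℝ) ≠ 1 / 2 → N ≤ charLength ε t) →
          c * ((N : ℝ) ^ 2 * critFourArmProb r₀ N) ≤ rhombusPivotalSum t N) :
    ∃ r₁ : ℕ, ∀ r₀ ≥ r₁, ∃ δ > (0 : ℝ), ∃ C : ℝ,
      ∀ p : unitInterval, (p : ℝ) ≠ 1 / 2 → |(p : ℝ) - 1 / 2| < δ →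
        |(p : ℝ) - 1 / 2| * (charLength ε p : ℝ) ^ 2 * critFourArmProb r₀ (charLength ε p) ≤ C := by
  have h7 : BollobasRiordan2006_ch5_lemma7 := BollobasRiordan2006_ch5_lemma7_holds
  have hsub : Nolin2008_subcritical_crossing :=
    Nolin2008_subcritical_crossing_of_expDecay BollobasRiordan2006_tri_expDecay_holds
  obtain ⟨r₁, hr₁⟩ := hlow
  refine ⟨r₁, fun r₀ hr₀ => ?_⟩
  obtain ⟨n₁, δ, hδ, c, hc, hb⟩ := hr₁ r₀ hr₀
  obtain ⟨δL, hδL, hL⟩ := le_charLength_eventually h7 hsub hε hε' n₁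
  set δ' : ℝ := min (min δ δL) (1 / 4) with hδ'
  have hδ'δ : δ' ≤ δ := (min_le_left _ _).trans (min_le_left _ _)
  have hδ'L : δ' ≤ δL := (min_le_left _ _).trans (min_le_right _ _)
  have hδ'4 : δ' ≤ 1 / 4 := min_le_right _ _
  have hδ'0 : 0 < δ' := lt_min (lt_min hδ hδL) (by norm_num)
  have hL' : ∀ p : unitInterval, 1 / 2 - δ' < (p : ℝ) → (p : ℝ) < 1 / 2 → n₁ ≤ charLength ε p :=
    fun p h1 h2 => hL p (by linarith) h2
  refine ⟨δ', hδ'0, 1 / (2 * c), fun p hne hpδ => ?_⟩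
  rcases lt_or_gt_of_ne hne with hp | hp
  · exact KestenScalingProofs.upper_of_lt_half hε hc hb hδ'δ hδ'4 hL' hp hpδ
  · -- `p > 1/2`: apply the previous case to `1 - p`
    have hq : ((σ p : unitInterval) : ℝ) < 1 / 2 := by
      rw [unitInterval.coe_symm_eq]; linarith
    have hqδ : |((σ p : unitInterval) : ℝ) - 1 / 2| < δ' := by
      rw [unitInterval.coe_symm_eq, show (1 : ℝ) - p - 1 / 2 = -((p : ℝ) - 1 / 2) by ring,
        abs_neg]
      exact hpδ
    have h := KestenScalingProofs.upper_of_lt_half hε hc hb hδ'δ hδ'4 hL' hq hqδ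
    rw [charLength_symm, unitInterval.coe_symm_eq,
      show (1 : ℝ) - p - 1 / 2 = -((p : ℝ) - 1 / 2) by ring, abs_neg] at h
    exact h

/-- **Lower bound of Kesten's relation from the upper pivotal count, at a fixed `ε`** (Nolin 2008,
proof of Prop. 34 [arXiv: Prop. 32]; Werner 2009, Lecture 6, display after Lemma 6.3:
`(p₀ - 1/2) L(p₀)² π̂_{1/2}(L(p₀)) ≥ h_{p₀}(L(p₀)) - h_{1/2}(L(p₀))`, "this lower bound is also
bounded from below … because of the definition of `L(p)`"): if for every large inner radius `r₀`
the upper pivotal bound `Σ_{v ∈ [0,N]²} P_t(v pivotal) ≤ C N² π₄(N)` holds for `t` near `1/2` and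
`n₁ ≤ N ≤ L_ε(t)`, then `c ≤ |p - 1/2| L_ε(p)² π₄(L_ε(p))` with `c > 0` on a punctured
neighbourhood of `1/2`. [cite: Nolin2008, §7.3, proof of Prop. 34 (arXiv 0711.4948: Prop. 32)] [cite: WernerPCMI2009, Lecture 6, display after Lemma 6.3] -/
theorem Nolin2008_prop34_lower_at_of_pivotal_upper {ε : ℝ} (hε : 0 < ε) (hε' : ε < 1 / 2)
    (hup : ∃ r₁ : ℕ, ∀ r₀ ≥ r₁, ∃ n₁ : ℕ, ∃ δ > (0 : ℝ), ∃ C : ℝ,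
      ∀ t : unitInterval, |(t : ℝ) - 1 / 2| < δ →
        ∀ N : ℕ, n₁ ≤ N → ((t : ℝ) ≠ 1 / 2 → N ≤ charLength ε t) →
          rhombusPivotalSum t N ≤ C * ((N : ℝ) ^ 2 * critFourArmProb r₀ N)) :
    ∃ r₁ : ℕ, ∀ r₀ ≥ r₁, ∃ δ > (0 : ℝ), ∃ c > (0 : ℝ),
      ∀ p : unitInterval, (p : ℝ) ≠ 1 / 2 → |(p : ℝ) - 1 / 2| < δ →
        c ≤ |(p : ℝ) - 1 / 2| * (charLength ε p : ℝ) ^ 2 * critFourArmProb r₀ (charLength ε p) := by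
  have h7 : BollobasRiordan2006_ch5_lemma7 := BollobasRiordan2006_ch5_lemma7_holds
  have hsub : Nolin2008_subcritical_crossing :=
    Nolin2008_subcritical_crossing_of_expDecay BollobasRiordan2006_tri_expDecay_holds
  obtain ⟨r₁, hr₁⟩ := hup
  refine ⟨r₁, fun r₀ hr₀ => ?_⟩
  obtain ⟨n₁, δ, hδ, C, hb⟩ := hr₁ r₀ hr₀
  obtain ⟨δL, hδL, hL⟩ := le_charLength_eventually h7 hsub hε hε' n₁
  set δ' : ℝ := min (min δ δL) (1 / 4) with hδ'
  have hδ'δ : δ' ≤ δ := (min_le_left _ _).trans (min_le_left _ _)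
  have hδ'L : δ' ≤ δL := (min_le_left _ _).trans (min_le_right _ _)
  have hδ'4 : δ' ≤ 1 / 4 := min_le_right _ _
  have hδ'0 : 0 < δ' := lt_min (lt_min hδ hδL) (by norm_num)
  have hL' : ∀ p : unitInterval, 1 / 2 - δ' < (p : ℝ) → (p : ℝ) < 1 / 2 → n₁ ≤ charLength ε p :=
    fun p h1 h2 => hL p (by linarith) h2
  refine ⟨δ', hδ'0, (1 / 2 - ε) / max C 1, div_pos (by linarith) (lt_max_of_lt_right one_pos),
    fun p hne hpδ => ?_⟩
  rcases lt_or_gt_of_ne hne with hp | hp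
  · exact KestenScalingProofs.lower_of_lt_half hε hb hδ'δ hδ'4 hL' hp hpδ
  · -- `p > 1/2`: apply the previous case to `1 - p`
    have hq : ((σ p : unitInterval) : ℝ) < 1 / 2 := by
      rw [unitInterval.coe_symm_eq]; linarith
    have hqδ : |((σ p : unitInterval) : ℝ) - 1 / 2| < δ' := by
      rw [unitInterval.coe_symm_eq, show (1 : ℝ) - p - 1 / 2 = -((p : ℝ) - 1 / 2) by ring,
        abs_neg]
      exact hpδ
    have h := KestenScalingProofs.lower_of_lt_half hε hb hδ'δ hδ'4 hL' hq hqδ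
    rw [charLength_symm, unitInterval.coe_symm_eq,
      show (1 : ℝ) - p - 1 / 2 = -((p : ℝ) - 1 / 2) by ring, abs_neg] at h
    exact h

/-! ### Kesten's relation at a fixed `ε`, and from its single remaining leaf -/

/-- **Kesten's relation at ONE fixed `ε ∈ (0, 1/2)` from the pivotal count at that `ε`** (Nolin
2008, Prop. 34 [arXiv: Prop. 32], "for any fixed `ε ∈ (0, 1/2)`"; Werner 2009, Lecture 6,
Cor. 6.3 – Lemma 6.3 and the display following them): the body of `Nolin2008_prop34` at `ε` —
exactly the hypothesis `hK` of the `_at` assembly `triTheta_exponent_of_scaling_at`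
(`KestenScaling.lean`) — follows from the two-sided pivotal count
`Σ_{v ∈ [0,N]²} P_t(v pivotal) ≍ N² π₄(N)` for `t` near `1/2`, `n₁ ≤ N ≤ L_ε(t)` (the body of
`Werner2009_lemma62` at `ε`), the self-duality of the rhombus and the sub-critical decay being
the tree's theorems. Proof: `Nolin2008_prop34_of_lt_half` (`KestenRelationRusso.lean`) on both
sides of `1/2`. [cite: Nolin2008, §7.3, Prop. 34 (arXiv 0711.4948: Prop. 32)] [cite: WernerPCMI2009, Lecture 6, Cor. 6.3 and display after Lemma 6.3] -/
theorem Nolin2008_prop34_at_of_pivotalCount {ε : ℝ} (hε : 0 < ε) (hε' : ε < 1 / 2)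
    (h62 : ∃ r₁ : ℕ, ∀ r₀ ≥ r₁, ∃ n₁ : ℕ, ∃ δ > (0 : ℝ), ∃ c > (0 : ℝ), ∃ C : ℝ,
      ∀ t : unitInterval, |(t : ℝ) - 1 / 2| < δ →
        ∀ N : ℕ, n₁ ≤ N → ((t : ℝ) ≠ 1 / 2 → N ≤ charLength ε t) →
          c * ((N : ℝ) ^ 2 * critFourArmProb r₀ N) ≤ rhombusPivotalSum t N ∧
            rhombusPivotalSum t N ≤ C * ((N : ℝ) ^ 2 * critFourArmProb r₀ N)) :
    ∃ r₁ : ℕ, ∀ r₀ ≥ r₁, ∃ δ > (0 : ℝ), ∃ c > (0 : ℝ), ∃ C : ℝ,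
      ∀ p : unitInterval, (p : ℝ) ≠ 1 / 2 → |(p : ℝ) - 1 / 2| < δ →
        c ≤ |(p : ℝ) - 1 / 2| * (charLength ε p : ℝ) ^ 2 * critFourArmProb r₀ (charLength ε p) ∧
          |(p : ℝ) - 1 / 2| * (charLength ε p : ℝ) ^ 2 * critFourArmProb r₀ (charLength ε p) ≤
            C := by
  have h7 : BollobasRiordan2006_ch5_lemma7 := BollobasRiordan2006_ch5_lemma7_holds
  have hsub : Nolin2008_subcritical_crossing :=
    Nolin2008_subcritical_crossing_of_expDecay BollobasRiordan2006_tri_expDecay_holds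
  obtain ⟨r₁, hr₁⟩ := h62
  refine ⟨r₁, fun r₀ hr₀ => ?_⟩
  obtain ⟨n₁, δ, hδ, c, hc, C, hb⟩ := hr₁ r₀ hr₀
  obtain ⟨δL, hδL, hL⟩ := le_charLength_eventually h7 hsub hε hε' n₁
  set δ' : ℝ := min (min δ δL) (1 / 4) with hδ'
  have hδ'δ : δ' ≤ δ := (min_le_left _ _).trans (min_le_left _ _)
  have hδ'L : δ' ≤ δL := (min_le_left _ _).trans (min_le_right _ _)
  have hδ'4 : δ' ≤ 1 / 4 := min_le_right _ _
  have hδ'0 : 0 < δ' := lt_min (lt_min hδ hδL) (by norm_num)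
  have hL' : ∀ p : unitInterval, 1 / 2 - δ' < (p : ℝ) → (p : ℝ) < 1 / 2 → n₁ ≤ charLength ε p :=
    fun p h1 h2 => hL p (by linarith) h2
  refine ⟨δ', hδ'0, (1 / 2 - ε) / max C 1, div_pos (by linarith) (lt_max_of_lt_right one_pos),
    1 / (2 * c), fun p hne hpδ => ?_⟩
  rcases lt_or_gt_of_ne hne with hp | hp
  · exact Nolin2008_prop34_of_lt_half h7 hsub hε hc hb hδ'δ hδ'4 hL' hp hpδ
  · -- `p > 1/2`: apply the previous case to `1 - p`
    have hq : ((σ p : unitInterval) : ℝ) < 1 / 2 := by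
      rw [unitInterval.coe_symm_eq]; linarith
    have hqδ : |((σ p : unitInterval) : ℝ) - 1 / 2| < δ' := by
      rw [unitInterval.coe_symm_eq, show (1 : ℝ) - p - 1 / 2 = -((p : ℝ) - 1 / 2) by ring,
        abs_neg]
      exact hpδ
    have h := Nolin2008_prop34_of_lt_half h7 hsub hε hc hb hδ'δ hδ'4 hL' hq hqδ
    rw [charLength_symm, unitInterval.coe_symm_eq,
      show (1 : ℝ) - p - 1 / 2 = -((p : ℝ) - 1 / 2) by ring, abs_neg] at h
    exact h

/-- **Kesten's scaling relation from its single remaining leaf**: the named fact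
`Nolin2008_prop34` (`|p - 1/2| L_ε(p)² π₄(L_ε(p)) ≍ 1` for every `ε ∈ (0, 1/2)`; Nolin 2008,
Prop. 34 [arXiv: Prop. 32]; Kesten 1987, (4.5)) follows from the pivotal count below the
characteristic length `Werner2009_lemma62` alone — the self-duality of the rhombus
(`BollobasRiordan2006_ch5_lemma7_holds`) and the sub-critical decay of rhombus crossings
(`BollobasRiordan2006_tri_expDecay_holds` with `Nolin2008_subcritical_crossing_of_expDecay`)
being theorems of the tree. The discharge `Nolin2008_prop34_holds` is this theorem applied to
`Werner2009_lemma62_holds`. [cite: Nolin2008, §7.3, Prop. 34 (arXiv 0711.4948: Prop. 32)] [cite: KestenScalingCMP1987, (4.5) (as cited by van den Berg–Nolin arXiv:1512.05335 §2.2 (viii))] [cite: WernerPCMI2009, Lecture 6, Cor. 6.3 and display after Lemma 6.3] -/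
theorem Nolin2008_prop34_of_lemma62 (h62 : Werner2009_lemma62) : Nolin2008_prop34 :=
  Nolin2008_prop34_of_expDecay BollobasRiordan2006_tri_expDecay_holds h62

end Literature.Probability.Percolation
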